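import Summits.BirchSwinnertonDyer.BirchSwinnertonDyer.Theses.BiquadraticEisensteinDescent
import Summits.BirchSwinnertonDyer.BirchSwinnertonDyer.Theorems.InertBadSignedBranchesInertBadAtThreeGlue
import HarnessLib

/-!
# Skeleton `k8-split` for crux `InertBadAtThree` (stmt-BirchSwinnertonDyer-19225) as wanted by route
# `BiquadraticEisensteinDescent` (R₃, rank 5) — the EXISTING ledger split of the shared item, typed for BED's decl

Crux-plan by the row-12 lead `bsd-wall-cm-bed-p1` g0 (2026-08-28, D-0152 M1). The item is SHARED VERBATIM with
route `InertBadSignedBranches` (K8), where it is ALREADY SPLIT (gen 1) into the children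
`InertBadAtThreeIstarZero` (stmt-BirchSwinnertonDyer-19656, the `(3, I₀*)` part: 57 pairs, attacked by K8's signed
η-branch chain at `p = 3`) and `InertBadAtThreeOffIstarZero` (stmt-BirchSwinnertonDyer-19657, `j = 1728` quartic
twists with type III/III* at 3: 97 pairs, HELD residual — no quadratic twin with good reduction at 3 exists) with
the glue `InertBadAtThreeGlue` (stmt-BirchSwinnertonDyer-19658) PROVED
(`Theorems.inertBadSignedBranches_inertBadAtThreeGlue_proof`). BED's decl and K8's decl have the same body, so the
K8 glue closes BED's decl from the same two children. This file records that as BED's line: the two stubs ARE the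
two child items (signatures verbatim; do not re-file them), and `InertBadAtThree_of` is kernel-checked. Nothing new
is claimed; `p = 3` stays outside BED's own lever (Hsieh's hypothesis (1) contains the factor 3).
lean rc 0, sorries 2 = stubs. v2 (lead `bsd-line-ibd-p1` g0, 2026-08-28): adds `InertBadAtThree_proof` concluding the
K8 decl `InertBadSignedBranches.InertBadAtThree` by name as well (the shared item's skeleton check resolves the crux
decl to the first sharing route); stubs unchanged. BSD is not proved by any of this.
-/

set_option linter.dupNamespace false
set_option autoImplicit false

noncomputable section

open scoped Classical

open WeierstrassCurve Literature.NumberTheory.EllipticCurves Literature.NumberTheory.EllipticCurves.Rank1Residual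

namespace Summit.BirchSwinnertonDyer.BirchSwinnertonDyer.Cruxes.InertBadAtThree.K8Split

open Summit.BirchSwinnertonDyer.BirchSwinnertonDyer.Theses

/-- STUB `stub_istarZero` (= item stmt-BirchSwinnertonDyer-19656 `InertBadSignedBranches.InertBadAtThreeIstarZero`
VERBATIM; attacked by route K8's η-branch chain at `p = 3` — the `p ≥ 5` chain GZ_η ⟹ C-cc-1 ⟹ BSD_p re-run at 3
with the `μ₆`/3-torsion bookkeeping; not BED's lever). -/
theorem stub_istarZero : InertBadSignedBranches.InertBadAtThreeIstarZero := by
  sorry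

/-- STUB `stub_offIstarZero` (= item stmt-BirchSwinnertonDyer-19657 `InertBadSignedBranches.InertBadAtThreeOffIstarZero`
VERBATIM; HELD residual: `j = 1728`, type III/III* at 3 — no signed 3-adic theory for a quartic twist is stated in
print; CONSTRUCTION-shaped). -/
theorem stub_offIstarZero : InertBadSignedBranches.InertBadAtThreeOffIstarZero := by
  sorry

/-- COMPOSITION, K8 side (kernel-checked; v2, lead `bsd-line-ibd-p1` g0): the SHARED item's first route decl
`InertBadSignedBranches.InertBadAtThree` BY NAME, from the two K8 children by the PROVED K8 glue (item 19658). The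
item stmt-BirchSwinnertonDyer-19225 is `shared_closes` for BOTH routes; the ledger's skeleton check resolves the crux
decl to this one, so the skeleton concludes both decls by name (this theorem and `InertBadAtThree_of`). -/
theorem InertBadAtThree_proof : InertBadSignedBranches.InertBadAtThree :=
  Summit.BirchSwinnertonDyer.BirchSwinnertonDyer.Theorems.inertBadSignedBranches_inertBadAtThreeGlue_proof
    stub_istarZero stub_offIstarZero

/-- COMPOSITION, BED side (kernel-checked): BED's `InertBadAtThree` — THE ROUTE DECL BY NAME — from the two K8
children by the PROVED K8 glue (the two route decls have the same body, so `exact` crosses the namespaces). -/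
theorem InertBadAtThree_of : BiquadraticEisensteinDescent.InertBadAtThree := by
  have h : InertBadSignedBranches.InertBadAtThree := InertBadAtThree_proof
  exact h

end Summit.BirchSwinnertonDyer.BirchSwinnertonDyer.Cruxes.InertBadAtThree.K8Split

end
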